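import Summits.Ventures.Crystal3D.Bulk.GapTightLevels
import Literature.Geometry.DiscreteGeometry.Fan
import HarnessLib

/-!
# Planarity of the two-level tight graph of an admissible fourteen-ball configuration
# (DESIGN-L12-THEORY P-L3(a); Musin–Tarasov 2012 Prop. 3.1 adapted to two thresholds) — the
# tight graph is a FAN (Hales)

HONEST FRAMING. Part of the venture `Summits/Ventures/Crystal3D` (cell `pub-crystal3d`, phase 2,
24-hour sprint `PLAN.md` R42/R43; seat typer-bulk-2). A brick of the census completeness
hypothesis `GapCensus.Complete` (`Bulk/GapCensusSkeleton.lean`; cell file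
`phase2/ENV-CENSUS/DESIGN-L12-THEORY.md`, validity table T1, row P-L3a "planarity of `T` drawn by
minor arcs — CORE"): the enumerate-and-kill census of the sprint generates PLANE graphs (plantri
class), which is justified only if the tight graph of every configuration it must cover is drawn
on the sphere without crossings. The one-threshold model is Musin–Tarasov 2012, Prop. 3.1, IN THE
TREE as `Literature…SphericalCodeContactGraph.isFan_codeContactGraph` (the contact graph of a
spherical code at one level `κ` is a fan in Hales's sense, `Literature…Fan.IsFan`: `0 ∉ V`, edges
not collinear with `0`, and `C(ε) ∩ C(ε′) = C(ε ∩ ε′)` for all cells — the cone over a tight pair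
meeting the unit sphere exactly in its minor great-circle arc). THIS file proves the TWO-LEVEL
version the GAP census needs, for EVERY admissible configuration (`IsGapConfig`, no extremality),
from the cone lemmas and levels of `Bulk/GapTightLevels.lean`:

* the thirteen unit DIRECTIONS seen from ball `0` (`gapDir`: the twelve shell vectors
  `c j − c 0` and the intruder's direction `p`), with the TIGHT pairs as edges (`tightGraph` on
  `tightVertices`: shell–shell pairs at distance `1`, i.e. directions at `60°`, inner product
  `1/2`; shell–intruder pairs at distance `1`, i.e. directions at the hole radius `ρ`, inner
  product `D/2`, `D = intruderDist c`), form a FAN whenever `D² < 3`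
  (**`IsGapConfig.isFan_tightGraph`**): no two tight arcs cross, two tight arcs at a common
  vertex overlap only in that vertex, no third vertex lies on a tight arc, no two vertices
  coincide. `D² < 3` (hole radius `> 30°`) covers the whole census window `D ≤ 1.26` and is
  SHARP for the statement: at `D = √3` the hole direction may lie ON a contact arc (`ρ = 30°`,
  `60° − ρ = ρ`).
* Index form without the set/graph packaging: `IsGapConfig.cone_pair_inter_cone_pair_subset`
  (two tight pairs with no common ball: cones meet only at `0`; `D < 2` suffices) and
  `IsGapConfig.cone_pair_inter_cone_pair_eq` (`= {0}`),
  `IsGapConfig.cone_pair_inter_cone_pair_subset_cone_singleton` (common ball: cones meet inside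
  its ray), `IsGapConfig.cone_pair_inter_cone_singleton_subset` (no third direction on a tight
  arc). Case analysis on where the intruder sits: the equal-level cases are the tree's
  `unit_eq_zero_of_edge_pair_pair / _shared / _ray` at level `1/2` (or `D/2` at the intruder),
  the mixed cases are the two-level lemmas of `Bulk/GapTightLevels.lean`.

Nothing is claimed about GAP(1.26); faces of the fan (P-L3(b), Lemma L, face sizes) are NOT here.
-/

noncomputable section

open scoped BigOperators InnerProductSpace
open Finset Real

namespace Summit.Ventures.Crystal3D

open Literature.Geometry.DiscreteGeometry

section Config

variable {c : Fin 14 → EuclideanSpace ℝ (Fin 3)}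

/-! ## Planarity, index form: cones over tight pairs meet only along common cells -/

/-- **Two tight pairs with no ball in common do not cross** (their cones meet only at `0`), for
every admissible configuration with intruder distance `< 2`: two contact edges — the tree's
`unit_eq_zero_of_edge_pair_pair` at level `1/2`; a hole edge against a contact edge —
`unit_eq_zero_of_holeEdge_pair` at levels `D/2`, `1/2` (`2(D/2)² < 2 ⇔ D < 2`).
(DESIGN-L12-THEORY P-L3(a); Musin–Tarasov 2012 Prop. 3.1, two thresholds.) -/
theorem IsGapConfig.cone_pair_inter_cone_pair_subset (hc : IsGapConfig c)
    (hD : intruderDist c < 2) {i j k l : Fin 14} (hi0 : i ≠ 0) (hj0 : j ≠ 0) (hk0 : k ≠ 0)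
    (hl0 : l ≠ 0) (hij : dist (c i) (c j) = 1) (hkl : dist (c k) (c l) = 1) (hik : i ≠ k)
    (hil : i ≠ l) (hjk : j ≠ k) (hjl : j ≠ l) :
    cone ({gapDir c i, gapDir c j} : Set (EuclideanSpace ℝ (Fin 3))) ∩
      cone {gapDir c k, gapDir c l} ⊆ {0} := by
  have hD1 := hc.one_le_intruderDist
  -- WLOG the intruder is not among `k, l`
  wlog hkl13 : k ≠ 13 ∧ l ≠ 13 generalizing i j k l
  · rw [Set.inter_comm]
    refine this hk0 hl0 hi0 hj0 hkl hij hik.symm hjk.symm hil.symm hjl.symm ⟨?_, ?_⟩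
    · rintro rfl
      exact hkl13 ⟨hik.symm, hil.symm⟩
    · rintro rfl
      exact hkl13 ⟨hjk.symm, hjl.symm⟩
  obtain ⟨hk13, hl13⟩ := hkl13
  -- WLOG `j` is not the intruder
  wlog hj13 : j ≠ 13 generalizing i j
  · have hj : j = 13 := not_not.1 hj13
    have hi13 : i ≠ 13 := fun h => index_ne_of_dist_eq_one hij (h.trans hj.symm)
    rw [Set.pair_comm]
    exact this hj0 hi0 (by rw [dist_comm]; exact hij) hjk hjl hik hil hi13
  intro x ⟨hx1, hx2⟩
  obtain ⟨s, u, hs, hu, rfl⟩ := mem_cone_pair.1 hx1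
  obtain ⟨s', t', hs', ht', hx⟩ := mem_cone_pair.1 hx2
  have hkl' := hc.inner_gapDir_eq hk0 hl0 hkl
  rw [tightLevel_of_ne hk13 hl13] at hkl'
  have hjk' := hc.inner_gapDir_le hj0 hk0 hjk
  have hjl' := hc.inner_gapDir_le hj0 hl0 hjl
  rw [tightLevel_of_ne hj13 hk13] at hjk'
  rw [tightLevel_of_ne hj13 hl13] at hjl'
  have hij' := hc.inner_gapDir_eq hi0 hj0 hij
  have hik' := hc.inner_gapDir_le hi0 hk0 hik
  have hil' := hc.inner_gapDir_le hi0 hl0 hil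
  by_cases hi13 : i = 13
  · -- a hole edge against a contact edge
    subst hi13
    rw [tightLevel_of_left] at hij' hik' hil'
    obtain ⟨rfl, rfl, -, -⟩ := unit_eq_zero_of_holeEdge_pair (hc.norm_gapDir hi0)
      (hc.norm_gapDir hj0) (hc.norm_gapDir hk0) (hc.norm_gapDir hl0) (t := intruderDist c / 2)
      (κ := 1 / 2) (by linarith) (by norm_num) (by norm_num) (by nlinarith) hij' hkl' hik' hil'
      hjk' hjl' hs hu hs' ht' hx.symm
    simp
  · -- two contact edges (tree lemma, level `1/2`)
    rw [tightLevel_of_ne hi13 hj13] at hij'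
    rw [tightLevel_of_ne hi13 hk13] at hik'
    rw [tightLevel_of_ne hi13 hl13] at hil'
    obtain ⟨rfl, rfl⟩ := unit_eq_zero_of_edge_pair_pair (hc.norm_gapDir hi0) (hc.norm_gapDir hj0)
      (hc.norm_gapDir hk0) (hc.norm_gapDir hl0) (κ := 1 / 2) (by norm_num) (by norm_num) hij' hkl'
      hik' hil' hjk' hjl' hs hu hs' ht' hx.symm
    simp

/-- **Two tight pairs with a common ball overlap only along that ball's ray** (their cones meet
inside `C{gapDir c i}`), for every admissible configuration with `intruderDist² < 3`: two hole
edges at the intruder or two contact edges at a shell ball — the tree's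
`unit_eq_zero_of_edge_pair_shared`; a hole edge and a contact edge at a shell ball —
`unit_eq_zero_of_holeEdge_shared` at levels `D/2`, `1/2` (`2(D/2)² < 3/2 ⇔ D² < 3`, sharp).
(DESIGN-L12-THEORY P-L3(a).) -/
theorem IsGapConfig.cone_pair_inter_cone_pair_subset_cone_singleton (hc : IsGapConfig c)
    (hD3 : intruderDist c ^ 2 < 3) {i j k : Fin 14} (hi0 : i ≠ 0) (hj0 : j ≠ 0) (hk0 : k ≠ 0)
    (hij : dist (c i) (c j) = 1) (hik : dist (c i) (c k) = 1) (hjk : j ≠ k) :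
    cone ({gapDir c i, gapDir c j} : Set (EuclideanSpace ℝ (Fin 3))) ∩
      cone {gapDir c i, gapDir c k} ⊆ cone {gapDir c i} := by
  have hD1 := hc.one_le_intruderDist
  have hD2 : intruderDist c < 2 := by nlinarith
  -- WLOG `k` is not the intruder
  wlog hk13 : k ≠ 13 generalizing j k
  · have hk : k = 13 := not_not.1 hk13
    rw [Set.inter_comm]
    exact this hk0 hj0 hik hij hjk.symm (fun h => hjk (h.trans hk.symm))
  intro x ⟨hx1, hx2⟩
  obtain ⟨s, u, hs, hu, rfl⟩ := mem_cone_pair.1 hx1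
  obtain ⟨s', t', hs', ht', hx⟩ := mem_cone_pair.1 hx2
  have hij' := hc.inner_gapDir_eq hi0 hj0 hij
  have hik' := hc.inner_gapDir_eq hi0 hk0 hik
  have hjk' := hc.inner_gapDir_le hj0 hk0 hjk
  suffices hu0 : u = 0 by
    subst hu0
    exact mem_cone_singleton.2 ⟨s, hs, by simp⟩
  by_cases hi13 : i = 13
  · -- two hole edges at the intruder (tree lemma)
    subst hi13
    have hj13 : j ≠ 13 := fun h => index_ne_of_dist_eq_one hij h.symm
    rw [tightLevel_of_left] at hij' hik'
    exact (unit_eq_zero_of_edge_pair_shared (hc.norm_gapDir hj0) (hc.norm_gapDir hk0)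
      (hc.gapDir_ne hD2 hj0 hk0 hjk) (hij'.trans hik'.symm) hu ht' hx.symm).1
  by_cases hj13 : j = 13
  · -- a hole edge and a contact edge at the shell ball `i`
    subst hj13
    rw [tightLevel_of_right] at hij'
    rw [tightLevel_of_ne hi13 hk13] at hik'
    rw [tightLevel_of_left] at hjk'
    exact (unit_eq_zero_of_holeEdge_shared (hc.norm_gapDir hi0) (hc.norm_gapDir hj0)
      (hc.norm_gapDir hk0) (t := intruderDist c / 2) (κ := 1 / 2) (by linarith) (by norm_num)
      (by norm_num) (by nlinarith) hij' hik' hjk' hu ht' hx.symm).1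
  · -- two contact edges at the shell ball `i` (tree lemma)
    rw [tightLevel_of_ne hi13 hj13] at hij'
    rw [tightLevel_of_ne hi13 hk13] at hik'
    exact (unit_eq_zero_of_edge_pair_shared (hc.norm_gapDir hj0) (hc.norm_gapDir hk0)
      (hc.gapDir_ne hD2 hj0 hk0 hjk) (hij'.trans hik'.symm) hu ht' hx.symm).1

/-- **No third direction lies on a tight arc** (the cone over a tight pair meets the ray of any
other direction only at `0`), for every admissible configuration with `intruderDist² < 3`: a
shell direction against a contact edge — the tree's `unit_eq_zero_of_edge_pair_ray`; the hole
direction against a contact edge — `unit_eq_zero_of_edge_pair_ray_twoLevel` (`D² < 3`, sharp);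
a shell direction against a hole edge — `unit_eq_zero_of_holeEdge_ray`.
(DESIGN-L12-THEORY P-L3(a).) -/
theorem IsGapConfig.cone_pair_inter_cone_singleton_subset (hc : IsGapConfig c)
    (hD3 : intruderDist c ^ 2 < 3) {i j k : Fin 14} (hi0 : i ≠ 0) (hj0 : j ≠ 0) (hk0 : k ≠ 0)
    (hij : dist (c i) (c j) = 1) (hki : k ≠ i) (hkj : k ≠ j) :
    cone ({gapDir c i, gapDir c j} : Set (EuclideanSpace ℝ (Fin 3))) ∩ cone {gapDir c k} ⊆ {0} := by
  have hD1 := hc.one_le_intruderDist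
  have hD2 : intruderDist c < 2 := by nlinarith
  -- WLOG `j` is not the intruder
  wlog hj13 : j ≠ 13 generalizing i j
  · have hj : j = 13 := not_not.1 hj13
    have hi13 : i ≠ 13 := fun h => index_ne_of_dist_eq_one hij (h.trans hj.symm)
    rw [Set.pair_comm]
    exact this hj0 hi0 (by rw [dist_comm]; exact hij) hkj hki hi13
  intro x ⟨hx1, hx2⟩
  obtain ⟨s, u, hs, hu, rfl⟩ := mem_cone_pair.1 hx1
  obtain ⟨r, hr, hx⟩ := mem_cone_singleton.1 hx2
  have hij' := hc.inner_gapDir_eq hi0 hj0 hij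
  have hik' := hc.inner_gapDir_le hi0 hk0 hki.symm
  have hjk' := hc.inner_gapDir_le hj0 hk0 hkj.symm
  by_cases hk13 : k = 13
  · -- the hole direction against a contact edge
    subst hk13
    rw [tightLevel_of_ne hki.symm hkj.symm] at hij'
    rw [tightLevel_of_right] at hik' hjk'
    obtain ⟨-, rfl, rfl⟩ := unit_eq_zero_of_edge_pair_ray_twoLevel (hc.norm_gapDir hi0)
      (hc.norm_gapDir hj0) (hc.norm_gapDir hk0) (κ := 1 / 2) (t := intruderDist c / 2)
      (by nlinarith) hij' hik' hjk' hs hu hr hx.symm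
    simp
  by_cases hi13 : i = 13
  · -- a shell direction against a hole edge
    subst hi13
    rw [tightLevel_of_left] at hij' hik'
    rw [tightLevel_of_ne hj13 hk13] at hjk'
    obtain ⟨-, rfl, rfl⟩ := unit_eq_zero_of_holeEdge_ray (hc.norm_gapDir hi0) (hc.norm_gapDir hj0)
      (hc.norm_gapDir hk0) (t := intruderDist c / 2) (κ := 1 / 2) (by linarith) (by norm_num)
      (by norm_num) (by nlinarith) hij' hik' hjk' hs hu hr hx.symm
    simp
  · -- a shell direction against a contact edge (tree lemma)
    rw [tightLevel_of_ne hi13 hj13] at hij'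
    rw [tightLevel_of_ne hi13 hk13] at hik'
    rw [tightLevel_of_ne hj13 hk13] at hjk'
    obtain ⟨-, rfl, rfl⟩ := unit_eq_zero_of_edge_pair_ray (hc.norm_gapDir hi0)
      (hc.norm_gapDir hj0) (hc.norm_gapDir hk0) (κ := 1 / 2) (by norm_num) (by norm_num) hij'
      hik' hjk' hs hu hr hx.symm
    simp

/-! ## The tight graph is a fan (Hales) -/

/-- The **vertex set of the tight graph**: the thirteen directions `gapDir c j`, `j ≠ 0`, as a
subset of `ℝ³`. -/
def tightVertices (c : Fin 14 → EuclideanSpace ℝ (Fin 3)) : Set (EuclideanSpace ℝ (Fin 3)) :=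
  {x | ∃ j : Fin 14, j ≠ 0 ∧ gapDir c j = x}

/-- The **two-level tight graph** of a configuration, drawn on the directions: two distinct
directions are adjacent iff they are the directions of two TOUCHING balls (distance exactly `1`)
other than ball `0` — shell–shell contacts (directions at `60°`) and shell–intruder contacts
(directions at the hole radius `ρ`). This is the graph `T = T(X, p)` of the cell's
DESIGN-L12-THEORY §T0 ("graph of tight pairs on 13 vertices, drawn by minor arcs"). -/
def tightGraph (c : Fin 14 → EuclideanSpace ℝ (Fin 3)) : SimpleGraph (tightVertices c) where
  Adj x y := (x : EuclideanSpace ℝ (Fin 3)) ≠ y ∧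
    ∃ i j : Fin 14, i ≠ 0 ∧ j ≠ 0 ∧ gapDir c i = x ∧ gapDir c j = y ∧ dist (c i) (c j) = 1
  symm := ⟨fun x y h => by
    obtain ⟨hne, i, j, hi0, hj0, hx, hy, hd⟩ := h
    exact ⟨hne.symm, j, i, hj0, hi0, hy, hx, by rw [dist_comm]; exact hd⟩⟩
  loopless := ⟨fun x h => h.1 rfl⟩

/-- Adjacency in the tight graph (definitional unfolding). -/
theorem tightGraph_adj {x y : tightVertices c} :
    (tightGraph c).Adj x y ↔ (x : EuclideanSpace ℝ (Fin 3)) ≠ y ∧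
      ∃ i j : Fin 14, i ≠ 0 ∧ j ≠ 0 ∧ gapDir c i = x ∧ gapDir c j = y ∧ dist (c i) (c j) = 1 :=
  Iff.rfl

/-- The vertex set is finite. -/
theorem finite_tightVertices (c : Fin 14 → EuclideanSpace ℝ (Fin 3)) :
    (tightVertices c).Finite :=
  (Set.finite_range (gapDir c)).subset (by rintro x ⟨j, -, rfl⟩; exact ⟨j, rfl⟩)

/-- **P-L3(a): THE TIGHT GRAPH OF AN ADMISSIBLE CONFIGURATION IS A FAN** (Hales 2012 Definition 3
= *Dense Sphere Packings* Definition 5.1, the tree's notion of a planar geodesic graph on the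
sphere, `Literature…Fan.IsFan`). For every admissible fourteen-ball configuration `c` with
`intruderDist c ^ 2 < 3` (hole radius `> 30°`; the census window has `intruderDist ≤ 1.26`), the
thirteen unit directions seen from ball `0` with the tight pairs as edges satisfy: `0` is not a
vertex, no edge is collinear with `0`, and the cones over any two cells (edges or vertices) meet
exactly in the cone over their common part — i.e. the minor great-circle arcs of two tight pairs
WITHOUT a common ball DO NOT MEET, the arcs of two tight pairs WITH a common ball meet ONLY IN
that ball's direction, NO third direction lies on a tight arc, and distinct balls have distinct
directions. One-threshold model: the tree's `isFan_codeContactGraph` (Musin–Tarasov 2012,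
Prop. 3.1: "Let `X` be a finite set in `S²`. Then `CG(X)` is a planar graph"); two-threshold
version: cell file DESIGN-L12-THEORY P-L3(a) ("two tight arcs meet only at common endpoints"),
the CORE row of the census completeness hypothesis `GapCensus.Complete` that licenses
enumerating PLANE graphs. The hypothesis `intruderDist² < 3` is sharp (at hole radius `30°` the
hole direction can lie on a contact arc). -/
theorem IsGapConfig.isFan_tightGraph (hc : IsGapConfig c) (hD3 : intruderDist c ^ 2 < 3) :
    IsFan (tightVertices c) (tightGraph c) := by
  have hD1 := hc.one_le_intruderDist
  have hD2 : intruderDist c < 2 := by nlinarith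
  -- vertices are unit vectors
  have hn : ∀ v : tightVertices c, ‖(v : EuclideanSpace ℝ (Fin 3))‖ = 1 := by
    rintro ⟨x, j, hj0, rfl⟩
    exact hc.norm_gapDir hj0
  have inj : ∀ {u v : tightVertices c}, (u : EuclideanSpace ℝ (Fin 3)) = v → u = v :=
    fun h => Subtype.ext h
  -- equal directions come from equal balls
  have idx : ∀ {i j : Fin 14}, i ≠ 0 → j ≠ 0 → gapDir c i = gapDir c j → i = j :=
    fun {i j} hi0 hj0 h => by_contra fun hij => hc.gapDir_ne hD2 hi0 hj0 hij h
  refine isFan_of_cone_inter (finite_tightVertices c) ⟨gapDir c 1, 1, by decide, rfl⟩ ?_ ?_ ?_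
    ?_ ?_ ?_
  · -- `0` is not a vertex
    rintro ⟨j, hj0, h⟩
    have := hc.norm_gapDir hj0
    rw [h, norm_zero] at this
    exact zero_ne_one this
  · -- edges are not collinear with `0`
    intro v w hvw
    obtain ⟨-, i, j, hi0, hj0, hv, hw, hd⟩ := hvw
    rw [← hv, ← hw]
    refine not_collinear_of_sq_inner_lt_one (hc.norm_gapDir hi0) (hc.norm_gapDir hj0) ?_
    rw [hc.inner_gapDir_eq hi0 hj0 hd]
    have h1 := tightLevel_lt_one hD2 i j
    have h2 := hc.half_le_tightLevel i j
    nlinarith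
  · -- two node rays
    intro u v huv x ⟨hxu, hxv⟩
    obtain ⟨s, hs, rfl⟩ := mem_cone_singleton.1 hxu
    obtain ⟨r, hr, hx⟩ := mem_cone_singleton.1 hxv
    obtain ⟨rfl, -⟩ := eq_zero_of_ray_ray (by rw [hn u, hn v]) (by rw [hn u]; norm_num)
      (fun h => huv (inj h)) hs hr hx.symm
    simp
  · -- a blade against the ray of a third node
    intro a b d hab hda hdb
    obtain ⟨-, i, j, hi0, hj0, ha, hb, hd⟩ := hab
    obtain ⟨k, hk0, hk⟩ := d.2
    have hki : k ≠ i := fun h => hda (inj (by rw [← hk, ← ha, h]))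
    have hkj : k ≠ j := fun h => hdb (inj (by rw [← hk, ← hb, h]))
    rw [← ha, ← hb, ← hk]
    exact hc.cone_pair_inter_cone_singleton_subset hD3 hi0 hj0 hk0 hd hki hkj
  · -- two blades with a common node
    intro a b d hab had hbd
    obtain ⟨-, i, j, hi0, hj0, ha, hb, hdij⟩ := hab
    obtain ⟨-, i', k, hi'0, hk0, ha', hk, hdik⟩ := had
    have hii' : i' = i := idx hi'0 hi0 (ha'.trans ha.symm)
    subst hii'
    have hjk : j ≠ k := fun h => hbd (inj (by rw [← hb, ← hk, h]))
    rw [← ha, ← hb, ← hk]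
    exact hc.cone_pair_inter_cone_pair_subset_cone_singleton hD3 hi'0 hj0 hk0 hdij hdik hjk
  · -- two blades of disjoint edges
    intro a b d e hab hde had hae hbd hbe
    obtain ⟨-, i, j, hi0, hj0, ha, hb, hdij⟩ := hab
    obtain ⟨-, k, l, hk0, hl0, hk, hl, hdkl⟩ := hde
    have hik : i ≠ k := fun h => had (inj (by rw [← ha, ← hk, h]))
    have hil : i ≠ l := fun h => hae (inj (by rw [← ha, ← hl, h]))
    have hjk : j ≠ k := fun h => hbd (inj (by rw [← hb, ← hk, h]))
    have hjl : j ≠ l := fun h => hbe (inj (by rw [← hb, ← hl, h]))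
    rw [← ha, ← hb, ← hk, ← hl]
    exact hc.cone_pair_inter_cone_pair_subset hD2 hi0 hj0 hk0 hl0 hdij hdkl hik hil hjk hjl

/-- **In particular (the printed planarity statement, two thresholds): the tight arcs of two
tight pairs without a common ball do not meet** — their cones intersect exactly in `{0}`. -/
theorem IsGapConfig.cone_pair_inter_cone_pair_eq (hc : IsGapConfig c) (hD : intruderDist c < 2)
    {i j k l : Fin 14} (hi0 : i ≠ 0) (hj0 : j ≠ 0) (hk0 : k ≠ 0) (hl0 : l ≠ 0)
    (hij : dist (c i) (c j) = 1) (hkl : dist (c k) (c l) = 1) (hik : i ≠ k) (hil : i ≠ l)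
    (hjk : j ≠ k) (hjl : j ≠ l) :
    cone ({gapDir c i, gapDir c j} : Set (EuclideanSpace ℝ (Fin 3))) ∩
      cone {gapDir c k, gapDir c l} = {0} :=
  Set.Subset.antisymm (hc.cone_pair_inter_cone_pair_subset hD hi0 hj0 hk0 hl0 hij hkl hik hil hjk hjl)
    (by rintro x rfl; exact ⟨zero_mem_cone _, zero_mem_cone _⟩)

end Config

end Summit.Ventures.Crystal3D
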